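import Literature.NumberTheory.EllipticCurves.KolyvaginShaStructureDivisibility
import HarnessLib

/-!
# Kolyvagin's structure theorem for `Ш(E/K)[p^∞]` under IRREDUCIBILITY of `ρ̄_{E,p}` (Cha 2005,
# Thm. 21 + Rmk. 25; Matar–Nekovář 2019, Thm. 0.7 + §0.9 + §0.11; Jetchev 2008, Rem. 6.2): the two
# one-sided consequences of `#Ш(E/K)[p^∞] = p^{2(M₀ − m)}` in McCallum's currency

Sibling of `KolyvaginShaStructureCertificate.lean` (`McCallum1991_pow_dvd_card_sha_primary_of_certificate`:
`p^{2(M₀ − M)} ∣ #Ш(E/K)[p^∞]` from ONE level-`(M+1)` certificate) and of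
`KolyvaginShaStructureDivisibility.lean`
(`McCallum1991_padicValNat_card_sha_primary_add_le_of_globalDivisibility`: `ord_p #Ш + 2t ≤ 2M₀` from
global `p^s`-divisibility of every derived point at every depth `s ≤ t`). Those two facts carry the
binder `∀ n, ρ̄_{E,p^n}` onto (the `p`-adic TOWER surjectivity, chosen by team `b2b-bsdres` as a safe
reading of McCallum's printed "`Gal(ℚ(E_p)/ℚ) = Gl₂(ℤ/pℤ)`"). This file states the SAME two
consequences of Kolyvagin's structure theorem with that binder REPLACED by "`E[p]` is an irreducible
`𝔽_p[G_ℚ]`-module" plus B. Cha's two standing hypotheses "`ℓ` does not divide `D`" and "`E` has a good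
or multiplicative reduction at `ℓ`" (`p ∤ d_K`, `p² ∤ N`) — the form in which the structure theorem is
asserted in print for IRREDUCIBLE, NOT NECESSARILY SURJECTIVE `ρ̄_{E,p}` (cell `bsd-stepL`, seat
`bsd-stepL-corner-p1`, rung K2 ∕ K2@3 items 19065 `NonSurjCorner` and 19111 `CornerAtThree`: the
non-surjective corner of class X11b — image of `ρ̄_{E,p}` of order prime to `p`, `p ∥ N` — where the
tower-surjective siblings are void by definition of the class).

## The printed statements (verbatim, read 2026-08-26 at the locators)

* B. Cha, *Vanishing of some cohomology groups and bounds for the Shafarevich–Tate groups of elliptic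
  curves*, J. Number Theory **111** (2005) 154–178 [held:
  `paper:cha2005-vanishing-some-cohomology-groups-bounds-shafarevich-tate`]. §5, p. 173 (p0020 L2–L4):
  *"For this section, our elliptic curve `E` is assumed to have no complex multiplication, unless stated
  otherwise."*; §5.1, p. 173 (L6–L12): *"Let `K = ℚ(√D)` be an imaginary quadratic extension with
  fundamental discriminant `D ≠ −3, −4` where all prime divisors of `N` split. The point `y_K ∈ E(K)`
  will denote the Heegner point associated with the maximal order in `K`. When `y_K` is of infinite
  order, `m` is defined to be the largest integer such that `y_K ∈ ℓ^m E(K)` modulo `ℓ`-torsion points.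
  By means of our Main Theorem obtained in Sections 2–4, we will prove Theorem 3 under the weaker
  assumption "`ρ_ℚ` irreducible", instead of "`ρ_ℚ` surjective"."*; **Theorem 21** (p. 173,
  L14–L19): *"Suppose that `y_K` is of infinite order. Assume that `ℓ` does not divide `D` and that
  `E` has a good or multiplicative reduction at `ℓ`. If the Galois representation
  `ρ_ℚ : Gal(ℚ̄/ℚ) ⟶ Aut(E[ℓ])` is irreducible over `ℤ/ℓℤ`, then `ord_ℓ |Ш(E/K)| ⩽ 2m`."*; proof,
  p. 173 (L25–L27): *"In [7], the surjectivity assumption is needed only for the proof of Proposition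
  2 in loc. cit. Therefore, it suffices to prove Proposition 2 only under the irreducibility
  assumption."* ([7] = Kolyvagin, *On the structure of Shafarevich–Tate groups*, LNM 1479);
  **Remark 25** (p. 175, p0022 L24–L27): *"In [7], Kolyvagin not only finds the bound of
  `ord_ℓ |Ш(E/K)|` but also determines the complete group structure of the `ℓ`-part of `Ш(E/K)` in
  terms of the (higher) Heegner points of `E`. This result also carries over mutatis mutandis only
  if we assume the irreducibility of `ρ_ℚ`."*
* A. Matar, J. Nekovář, J. Théor. Nombres Bordeaux **31** (2019) 455–501 [held:
  `paper:doi-10-5802-jtnb-1091`]. **0.7. Theorem** (p. 456, p0003 L32–L44) *"(Kolyvagin, [17, Thm. C,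
  Thm. D]). Assume that `D_K ≠ −3, −4` and that `p ≠ 2` is a prime number for which
  `ρ_{E,p} : G_ℚ ⟶ GL₂(ℤ_p)` has "big image" (e.g., that `ρ_{E,p}` is surjective). If
  `y_K ∉ E(K)_{tors}`, then `Ш(E/K)[p^∞] ≃ X ⊕ X`, `X ≃ ⊕_{i ≥ 0} ℤ/p^{m_i − m_{i+1}}ℤ`,
  `m₀ ≥ m₁ ≥ ⋯ ≥ m_∞ := inf m_i`, where `m₀` is as in Theorem 0.3 and `m_i` for `i > 0` is defined in
  a similar way in terms of certain linear combinations of Heegner points of higher conductors. In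
  particular, `#Ш(E/K)[p^∞] = p^{2(m₀ − m_∞)}`."*; **§0.9** (p. 457, p0004 L2–L12): *"For `p ≠ 2`,
  the condition (a) in Theorem 0.3 was studied in detail by Cha [3, Thm. 2], who showed that it is
  satisfied if `p ∤ D_K`, `p ∤ N` and `E(K)[p] = 0`, except when `p = 3` and … Therefore the
  conclusions of Theorems 0.3 and 0.5 hold (for `D_K ≠ −3, −4`) whenever `p ∤ 2D_K`, `p² ∤ N` and
  `ρ̄_{E,p}` is irreducible. He also showed [3, Thm. 21, Rmk. 25] that the statement of Theorem 0.7
  holds under the same assumptions."*; **§0.11** (p. 457, L24–L33): *"Lawson and Wuthrich [19] …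
  Their results imply that the condition (a) in Theorem 0.3 (for `p ≠ 2`) is always satisfied if
  `ρ̄_{E,p}` is irreducible. Consequently, the conclusions of Theorems 0.3 and 0.7 hold (for
  `D_K ≠ −3, −4`) if `ρ̄_{E,p}` is irreducible and `p ≠ 2`."*
* D. Jetchev, Compos. Math. **144** (2008) 811–826 [held: `paper:arxiv-math_0703431`]. §1 (p0003
  L32–L44): *"Hypothesis (\*): `p ∤ N` and … `ρ_{E,p}` is surjective. For such a prime [footnote:
  Recently, Byungchul Cha (see [cha:vanishing]) has been able to weaken Hypothesis (\*).] `p`,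
  Kolyvagin gives a precise formula … `#Ш(E/K)[p^∞] = p^{2(m₀ − m_∞)}` (1)"*; **Remark 6.2** (p0015
  L28–L31): *"Notice that Hypothesis (\*) can be weakened as the proof of [mccallum:kolyvagin] does not
  need the surjectivity of the Galois representation, but simply the weaker assumption that
  `End_{𝔽_p}(E[p])` is spanned (as an `𝔽_p`-vector space) by the elements `σ ∈ Gal(ℚ(E[p])/ℚ)`. This
  fact is equivalent to the absolute irreducibility of the Galois representation `ρ_{E,p}`."* (for
  the odd representation `E[p]` of `G_ℚ`, `p ≠ 2`, irreducible ⟺ absolutely irreducible: complex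
  conjugation has the two distinct rational eigenvalues `±1`).
* W. G. McCallum, LMS Lecture Note Ser. 153 (1991) 295–316, §5 Cor. 5.6 *"Let `m = min{M_i : i ≥ 0}`.
  Then `ord_p|Ш(E/K)| = 2(M_0 − m)`"*, the definition of `M_r`, `ord_p(P_n)`, Lemma 5.1, §4 `S_r(M)` —
  quoted in full in the two sibling files; McCallum's `M_i` are Kolyvagin's ∕ Matar–Nekovář's `m_i`.

## What is vendored, and how it differs from the siblings (never stronger than print)

The two `def`s below are the two sibling facts VERBATIM (same binders, same hypotheses on the
certificate ∕ on global divisibility, same conclusions, same three-line ∕ five-line derivations from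
Cor. 5.6 recorded in the siblings' module docstrings) with exactly these changes of binders:
`(∀ n, W.HasSurjectiveModNGaloisRep (p ^ n))` ↦ `W.HasIrreducibleModPGaloisRep p` ("`ρ_ℚ` irreducible
over `ℤ/ℓℤ`", Cha Thm. 21; "(b) … `ρ̄_{E,p}` is irreducible", MN19 Thm. 0.3), and TWO ADDED hypotheses
`¬ (p : ℤ) ∣ NumberField.discr K` ("`ℓ` does not divide `D`") and `¬ p ^ 2 ∣ W.conductorNorm ℤ`
("`E` has a good or multiplicative reduction at `ℓ`"; MN19 §0.9 "`p² ∤ N`") — Cha's standing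
hypotheses, KEPT although MN19 §0.11 drops them (the weaker = safer reading). Non-CM, `d_K ≠ −3, −4`,
`p ≠ 2`, the Heegner hypothesis and `y_K` of infinite order are the siblings' binders already and are
Cha's §5 ∕ §5.1 setting verbatim. The tree vocabulary (`KolyvaginHeegnerData`, `derivedPoint`,
`Zhang2014.IsKolyvaginPrime`, `kolyvaginIndex`, `ringClassField`) is the siblings'.

REFEREE FLAG `Cha05-Rmk25-structure` (recorded, not hidden; travels with the facts): the irreducible
form of the STRUCTURE theorem (as opposed to the BOUND `ord_ℓ |Ш(E/K)| ≤ 2m`, which is Cha's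
numbered Thm. 21 with a printed proof and is registered as `Cha2005.thm52_padicValNat_shaOrder_le` ∕
`MatarNekovar2019.thm03_padicValNat_card_sha_le_of_irreducible`) is printed as Cha's REMARK 25
("carries over mutatis mutandis"), restated as a result in Matar–Nekovář's refereed introduction
(§0.9 "He also showed [3, Thm. 21, Rmk. 25] that the statement of Theorem 0.7 holds under the same
assumptions"; §0.11) and in Jetchev's Rem. 6.2 (McCallum's proof of the structure theorem uses the
image only through the spanning of `End(E[p])`, i.e. absolute irreducibility); the supporting
in-body statement is Cha's p. 173 "In [7], the surjectivity assumption is needed only for the proof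
of Proposition 2 in loc. cit." with Proposition 2 re-proved under irreducibility (Lemmas 22–23,
pp. 174–175) — [7] being the structure paper itself. No line-by-line proof of Thm. 0.7 under
irreducibility is printed; three refereed sources assert it. Same standing as the registered
`Miller2011.thm54_…` (flag `Miller11-Thm54-Cha-case`). The flag's retirement is the referee's ruling.
FLAG ANNOTATION (referee ruling REF-44 (A), cell `bsd-print-x9`, 2026-08-27; registry token
`Cha05-Rmk25-remark-only` = this flag; the separate token `Kolyvagin1991-LNM1479-ThmCD-primary-unread`
is RETIRED into it): the primary [Kolyvagin1991StructureSha] (LNM 1479) is not held, but the author's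
companion paper V. A. Kolyvagin, *On the structure of Selmer groups*, Math. Ann. **291** (1991) 253–259
[held: `paper:doi-10-1007-bf01445205`] prints its standing hypotheses — §1, pp. 254–255 (p0002
L46–p0003 L2): *"We let `B(E)` denote the set of odd rational primes which do not divide the
discriminant of `𝒪 = End(E)` and for which the natural representation `ρ : G(ℚ̄/ℚ) → Aut_𝒪 T` is
surjective"*, p. 255 (p0003 L8–L10): *"in the paper "On the structure of Shafarevich–Tate groups" I
determined the structure of `Ш(K,E)_{ℓ^∞}` for `ℓ ∈ B(E)`, under the same condition"* (so the
lettered theorems cited as "Thm. C, Thm. D" after [MatarNekovar2019, Thm. 0.7] are `ℓ`-ADIC-SURJECTIVE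
statements, like McCallum's) — restates them (Thm. 1.2, p. 256, p0004 L31; Thm. 2.3, p. 259, p0007
L1), and asserts AT STATEMENT LEVEL, p. 259 (p0007 L42–L46): *"For `ℓ ∉ B(E)` the theory in [1] and
above holds with modifications in the manner of [2] … `τ_{λ,n}` is defined for all `λ ∈ Λ_{n+k₀}`
where `ℓ^{k₀/2} E(𝕂)_{ℓ^∞} = 0` … [`k₀ = 0` for `ℓ ∈ B(E)`]"*; on the frames of the two `def`s below
(`(irr_ℚ)`, `p` odd, `p ∤ d_K`, Heegner `K`) one has `E(𝕂)[p] = 0`, i.e. `k₀ = 0` (Matar–Nekovář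
2019 Prop. 5.31 (8) ∕ Prop. 6.5; kernel: `Summits/…/X9/LeafDischargeKolyvaginImage.lean`). The
irreducible-image STRUCTURE theorem thus stands in print at statement ∕ remark level in four refereed
texts (Kolyvagin 1991 Math. Ann. p. 259; Cha 2005 Rmk. 25; Matar–Nekovář 2019 §0.9 ∕ §0.11; Jetchev
2008 Rem. 6.2) with a line-by-line proof only under surjectivity (McCallum 1991 §5): class FLAGGED,
unchanged; nothing below is asserted.
Nothing is asserted (`def … : Prop`, D-0014); users take `(h : Cha2005.rmk25_…)`; no `_holds` is
expected (size XL: Kolyvagin's Euler system of Heegner points, the structure theorem, Cha's ∕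
Lawson–Wuthrich's cohomological vanishing).

References: [Cha2005] §5, §5.1, Thm. 21, Rmk. 25 (pp. 173–175); [MatarNekovar2019] Thm. 0.3, 0.7,
§0.9, §0.11 (pp. 456–457), Cor. 5.21 (e′), Prop. 5.26 (2) (pp. 490–492); [Jetchev2008] §1 (1),
footnote 1, Rem. 6.2; [Kolyvagin1991StructureSha] Thm. C, Thm. D; [Kolyvagin1991MathAnn] §1
pp. 254–255 (`ℓ ∈ B(E)`), Thm. 1.2 (p. 256), Thm. 2.3 and p. 259 L42–46 (`ℓ ∉ B(E)`); [McCallumLMS1991]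
§4 (S_r(M)), §5 (M_r, Lemma 5.1, Thm. 5.4, Cor. 5.6); [LawsonWuthrich2016] Thms. 1–2.
-/

noncomputable section

open scoped Classical

open WeierstrassCurve Literature.NumberTheory.EllipticCurves.ModularForms

namespace Literature.NumberTheory.EllipticCurves.Cha2005

/-- **Kolyvagin's structure theorem under irreducibility, LOWER half: `p^{2(M₀ − M)} ∣ #Ш(E/K)[p^∞]`
from ONE level-`(M+1)` certificate** — McCallum 1991 Cor. 5.6 *"`ord_p|Ш(E/K)| = 2(M_0 − m)`,
`m = min{M_i}`"* (`m ≤ M_{ω(n)} ≤ ord_p(P_n) ≤ M` for a certificate `(n, P_n ∉ p^{M+1}E(K_n))`, Lemma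
5.1 `M_0 = ord_p[E(K) : ℤy_K]`), valid for IRREDUCIBLE `ρ̄_{E,p}` by Cha 2005 Thm. 21 + Rmk. 25
(*"This result [Kolyvagin's determination of the complete group structure of the `ℓ`-part of `Ш(E/K)`
in terms of the (higher) Heegner points] also carries over mutatis mutandis only if we assume the
irreducibility of `ρ_ℚ`"*), Matar–Nekovář 2019 §0.9 (*"He also showed [3, Thm. 21, Rmk. 25] that the
statement of Theorem 0.7 [`#Ш(E/K)[p^∞] = p^{2(m₀ − m_∞)}`] holds under the same assumptions
[`p ∤ 2D_K`, `p² ∤ N`, `ρ̄_{E,p}` irreducible]"*) and Jetchev 2008 Rem. 6.2. TRANSCRIPTION = the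
sibling `McCallum1991_pow_dvd_card_sha_primary_of_certificate` VERBATIM with the tower-surjectivity
binder replaced by `W.HasIrreducibleModPGaloisRep p` and Cha's `p ∤ d_K`, `p² ∤ N` added: `W/ℚ`
globally minimal without CM, `N = W.conductorNorm ℤ`, `K` imaginary quadratic with the Heegner
hypothesis for `N`, `d_K ∉ {−3, −4}`, `p ≠ 2` with `p ∤ d_K`, `p² ∤ N` and `E[p]` irreducible,
`(Dt, β, ι)`, the conductor-`1` datum `d₁` and `P ∈ E(K)` with the same image in `E(K̄)` as
`P_1 = d₁.derivedPoint` (`P = y_K`), of infinite order, `M₀` with `p^{M₀} ∥ P` in `E(K)`; CERTIFICATE: a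
square-free `n` all of whose prime factors are Kolyvagin primes `ℓ` with `M + 1 ≤ M(ℓ)`, and a
Kolyvagin–Heegner datum `d` of conductor `n` with `P_n = d.derivedPoint ∉ p^{M+1} E(K_n)`. CONCLUSION:
`p ^ (2 (M₀ − M)) ∣ #Ш(E_K/K)[p^∞]`. Flag `Cha05-Rmk25-structure` (module docstring). Size XL; no
`_holds`. [cite: Cha2005, Thm. 21 and Rmk. 25 (pp. 173–175), §5–§5.1 setting (p. 173)]
[cite: MatarNekovar2019, Thm. 0.7 (p. 456), §0.9 and §0.11 (p. 457)]
[cite: Jetchev2008, §1 (1) with footnote 1, Rem. 6.2]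
[cite: McCallumLMS1991, §5 Cor. 5.6 (p. 314), Lemma 5.1 and M_r (p. 303), §4 S_r(M) (pp. 299–300)]
[cite: Kolyvagin1991StructureSha, Thm. C, Thm. D]
[cite: Kolyvagin1991MathAnn, §1 pp. 254–255 (ℓ ∈ B(E)), Thm. 1.2 (p. 256), Thm. 2.3 and p. 259 (ℓ ∉ B(E))] -/
def rmk25_pow_dvd_card_sha_primary_of_certificate : Prop :=
  ∀ (W : WeierstrassCurve ℚ) [W.IsElliptic] [W.IsGloballyMinimal] [NeZero (W.conductorNorm ℤ)],
    ¬ W.HasCM →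
    ∀ (K : Type) [Field K] [NumberField K], IsImaginaryQuadratic K →
    NumberField.discr K ≠ -3 → NumberField.discr K ≠ -4 →
    SatisfiesHeegnerHypothesis (W.conductorNorm ℤ) K →
    ∀ (p : ℕ) [Fact p.Prime], p ≠ 2 → ¬ (p : ℤ) ∣ NumberField.discr K →
      ¬ p ^ 2 ∣ W.conductorNorm ℤ → W.HasIrreducibleModPGaloisRep p →
    ∀ (Dt : ModularParametrizationData W (W.conductorNorm ℤ)) (β : ℤ) (ι : K →+* ℂ)
      (d₁ : KolyvaginHeegnerData Dt β ι 1) (P : (W.baseChange K).toAffine.Point),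
      d₁.toGeomPoints d₁.derivedPoint = toGeomPoints (W.baseChange K) P →
      ¬ IsOfFinAddOrder P →
    ∀ (M₀ : ℕ),
      (∃ Q : (W.baseChange K).toAffine.Point, ((p ^ M₀ : ℕ) : ℤ) • Q = P) →
      (¬ ∃ Q : (W.baseChange K).toAffine.Point, ((p ^ (M₀ + 1) : ℕ) : ℤ) • Q = P) →
    ∀ (n M : ℕ) (d : KolyvaginHeegnerData Dt β ι n), Squarefree n →
      (∀ ℓ ∈ n.primeFactors, Zhang2014.IsKolyvaginPrime (W.conductorNorm ℤ) W K p ℓ ∧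
        M + 1 ≤ Zhang2014.kolyvaginIndex W p ℓ) →
      (¬ ∃ Q : (W.baseChange (ringClassField K ι n)).toAffine.Point,
          ((p ^ (M + 1) : ℕ) : ℤ) • Q = d.derivedPoint) →
    p ^ (2 * (M₀ - M)) ∣ Nat.card (AddCommGroup.primaryComponent (W.baseChange K).sha p)

/-- **Kolyvagin's structure theorem under irreducibility, UPPER half: `ord_p #Ш(E/K)[p^∞] + 2t ≤ 2M₀`
when every derived Heegner point is `p^s`-divisible at every depth `s ≤ t`** — McCallum 1991 Cor.
5.6 read with `m ≥ t` (the five-line derivation of the sibling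
`McCallum1991_padicValNat_card_sha_primary_add_le_of_globalDivisibility`), valid for IRREDUCIBLE
`ρ̄_{E,p}` by Cha 2005 Thm. 21 + Rmk. 25, Matar–Nekovář 2019 Thm. 0.7 + §0.9 + §0.11
(*"the conclusions of Theorems 0.3 and 0.7 hold (for `D_K ≠ −3, −4`) if `ρ̄_{E,p}` is irreducible and
`p ≠ 2`"*) and Jetchev 2008 Rem. 6.2 (his Cor. 1.5 uses exactly this half). TRANSCRIPTION = that
sibling VERBATIM with the tower-surjectivity binder replaced by `W.HasIrreducibleModPGaloisRep p` and
Cha's `p ∤ d_K`, `p² ∤ N` added (binders as in `rmk25_pow_dvd_card_sha_primary_of_certificate`);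
HYPOTHESIS (global divisibility to depth `t`, i.e. `M_∞ ≥ t`): for every `s ≤ t`, every square-free
`n` every prime factor `ℓ` of which is a Kolyvagin prime with `s ≤ M(ℓ)`, and every Kolyvagin–Heegner
datum `d` of conductor `n` on the frame `(Dt, β, ι)`, `P_n = d.derivedPoint ∈ p^s E(K_n)`. CONCLUSION:
`ord_p #Ш(E_K/K)[p^∞] + 2t ≤ 2M₀`; with `t = 0` this is the `p`-primary form of Cha's Thm. 21 itself.
Flag `Cha05-Rmk25-structure` (module docstring). Size XL; no `_holds`.
[cite: Cha2005, Thm. 21 and Rmk. 25 (pp. 173–175), §5–§5.1 setting (p. 173)]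
[cite: MatarNekovar2019, Thm. 0.7 (p. 456), §0.9 and §0.11 (p. 457)]
[cite: Jetchev2008, §1 (1) and Cor. 1.5 with footnote 1, Rem. 6.2]
[cite: McCallumLMS1991, §5 Cor. 5.6 (p. 314), definition of M_r and ord_p(P_n) and Lemma 5.1 (p. 303); §4 S_r(M) (pp. 299–300)]
[cite: Kolyvagin1991StructureSha, Thm. C, Thm. D]
[cite: Kolyvagin1991MathAnn, §1 pp. 254–255 (ℓ ∈ B(E)), Thm. 1.2 (p. 256), Thm. 2.3 and p. 259 (ℓ ∉ B(E))] -/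
def rmk25_padicValNat_card_sha_primary_add_le_of_globalDivisibility : Prop :=
  ∀ (W : WeierstrassCurve ℚ) [W.IsElliptic] [W.IsGloballyMinimal] [NeZero (W.conductorNorm ℤ)],
    ¬ W.HasCM →
    ∀ (K : Type) [Field K] [NumberField K], IsImaginaryQuadratic K →
    NumberField.discr K ≠ -3 → NumberField.discr K ≠ -4 →
    SatisfiesHeegnerHypothesis (W.conductorNorm ℤ) K →
    ∀ (p : ℕ) [Fact p.Prime], p ≠ 2 → ¬ (p : ℤ) ∣ NumberField.discr K →
      ¬ p ^ 2 ∣ W.conductorNorm ℤ → W.HasIrreducibleModPGaloisRep p →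
    ∀ (Dt : ModularParametrizationData W (W.conductorNorm ℤ)) (β : ℤ) (ι : K →+* ℂ)
      (d₁ : KolyvaginHeegnerData Dt β ι 1) (P : (W.baseChange K).toAffine.Point),
      d₁.toGeomPoints d₁.derivedPoint = toGeomPoints (W.baseChange K) P →
      ¬ IsOfFinAddOrder P →
    ∀ (M₀ : ℕ),
      (∃ Q : (W.baseChange K).toAffine.Point, ((p ^ M₀ : ℕ) : ℤ) • Q = P) →
      (¬ ∃ Q : (W.baseChange K).toAffine.Point, ((p ^ (M₀ + 1) : ℕ) : ℤ) • Q = P) →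
    ∀ (t : ℕ),
      (∀ (s : ℕ), s ≤ t → ∀ (n : ℕ) (d : KolyvaginHeegnerData Dt β ι n), Squarefree n →
        (∀ ℓ ∈ n.primeFactors, Zhang2014.IsKolyvaginPrime (W.conductorNorm ℤ) W K p ℓ ∧
          s ≤ Zhang2014.kolyvaginIndex W p ℓ) →
        ∃ Q : (W.baseChange (ringClassField K ι n)).toAffine.Point,
          ((p ^ s : ℕ) : ℤ) • Q = d.derivedPoint) →
    padicValNat p (Nat.card (AddCommGroup.primaryComponent (W.baseChange K).sha p)) + 2 * t ≤ 2 * M₀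

end Literature.NumberTheory.EllipticCurves.Cha2005

end
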